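import Summits.ABC.IUTFork.Repair.CandInternal2RealGap
import HarnessLib

/-!
# IUT REPAIR BRANCH (rung LADDER-ABC:A2.RP → A2.RESCUE-H), class (i) INTERNAL, seat rp-d2 — `CandInternal2RealGapRows`: the GAP decider of
# `CandInternal2RealGap` at the R-W `λ_k` rows (`k = 1` top label) and at print's worked datum DH11a1 (R-H rows)

PROOF-ONLY file (D-0012; 0 definitions, 0 `Prop` facts) of the abc-iut cell, IUT REPAIR branch; seat abc-iut-rp-d2 gen 3 (D-0079 R-H kernel-eval
hand; CLAIM «GAP-I06STAR-NEG», STATUS 16:59:24Z). Sequel of `CandInternal2RealGap` (the valuation-only GAP test: an exponent strictly between two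
consecutive levels `φ_e(s₁) < N < φ_e(s₁+1)` of the norm spectrum of `log_p(𝒪_K^×)`, tie-free below `s₁`, is not attained). TAKES NO SIDE on
[IUTchIII] Cor. 3.12 or on any author; inputs ⊆ the frozen FACT-LIST; standard axioms. «refuted as typed» ≠ «refuted in print»; typed ≠ proved.

RESULTS (all FIELD-LEVEL: any `K/ℚ_p` — complete, nontrivially ultrametric-normed, `ProperSpace` — of the stated local type; at a fibre point
`x₀ | 7` of `pilotDataOfK T.D T.K` instantiate with `K := kOf … 7 x₀`, the norm of the chosen q-idele being abc-iut-rp-d4's bridge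
`Repair.EvalI06StarShape.norm_chosenQIdele_eq_unif_zpow` (p457897) — no `pilotDataOfK` bridge is re-derived here, per the 17:19:20Z split).
§1 TEMPLATES: `lamSeven_k1_l11_ev10_top` (R-W row `lamSeven:k=1:l=11 @p7.j5.ev10`: `e = 110`, `j = 5`, `N = −130 ∈ (φ(1), φ(2)) = (−171, −122)`,
`6 ∤ 110`) and print's worked datum **`dh11a1_label3_not_mem`** (Dupuy–Hilado 2004.13228v2 §2.10 via abc-iut-rp-h2's `EvalI06StarDH11a1`:
`p = 11`, `e = 78`, `‖q̲‖^{26} = 11^{−5}` so `m = 15`, `j = 3`, `N = 78 − 120 = −42 ∈ (φ(3), φ(4)) = (−45, −34)`, `10 ∤ 78`): the one OPEN label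
of that datum is NEG, so its label profile is `{1, 2}` POS / `{3, …, 6}` NEG as typed (with `EvalI06StarDH11a1.dh11a1_cells`). §2: the other
`λ_k` top-label cells at `k = 1` that were OPEN-shape (`l = 11`: `ev ∈ {6, 15, 30}`; `l = 13`: `ev ∈ {15, 30}`; the `6 ∣ e` rows use the bounded
tie check by `decide`) — with `CandInternal2RealHex` / the ball deciders every `lamSeven` top-label cell of the table is now NEG in kernel.
CONCORDANT LITERATURE LAYER (same classical law, found the same hour by four seats; cite BY NAME, nothing here restates it): abc-iut-c312-3
`Literature.IUT.LogVolume.UnitLogValuationSpectrum` (p457186, `LogEnvelope.*`), abc-iut-rp-d4 `UnitLogValuationProfile`, abc-iut-rp-x2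
`UnitLogValuationProfileBelowTies` (p457803); the Summits-side cell dictionary is `CandInternal2RealGap` (p457875, rp-x2 17:08:25Z split). Recipe for the
table (`plan/rescue/R-H/I06STAR-COLUMNS.tsv`): per NEG-gap row `CandInternal2RealGap.hex_cell_neg_of_bracket` with the row's literals
`(k, l, ev, j, s₁, a₁, a₂, A)` from `HOME/staging/repair/d2/RH/GAP-BRACKETS-v0.tsv` closes the cell exactly as in §1–§2 below.
[cite: NeukirchANT1999, Ch. II (5.5)] [cite: MochizukiAbsTopIII2015, Def 5.4 (iii) p. 126] [cite: Mochizuki2012, IUTchIV Cor. 2.2 (ii) proof (P5) p. 46]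
[claim: Mochizuki2012, status: disputed] for the quoted readings of RP-I06⋆.
-/

noncomputable section

namespace Summit.ABC.IUTFork.Repair.CandInternal2RealGapRows

open Set Metric
open scoped Pointwise
open Literature.AnabelianGeometry.AbsoluteAnabelian Literature.IUT.LogThetaLattice Literature.IUT.LogVolume
  Literature.IUT.LogVolume.RamificationCriterion Literature.NumberTheory.GaloisRepresentations.Ultrametric
  Summit.ABC.IUTFork.Repair.CandInternal2Real Summit.ABC.IUTFork.Repair.CandInternal2RealLabels
  Summit.ABC.IUTFork.Repair.CandInternal2RealGap

/-! ## §1. Templates: one R-W `λ_k` row and print's worked datum DH11a1, label 3 -/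

section Templates

/-- **ROW `lamSeven:k=1:l=11 @p7.j5.ev10`** (`e = 110`, top label `j = 5`, `N = 110 − 240 = −130`; bracket `s₁ = 1`, `a₁ = 2`
(`49 − 220 = −171 < −130`), `a₂ = 2` (`12, 84 < 110 ≤ 588`; `98 − 220 = −122 > −130`); `6 ∤ 110`): at every fibre point of local type
`e = 110` with `‖t_q‖ = 7^{−1/11}` the TOP-LABEL cell FAILS. [claim: Mochizuki2012, status: disputed] -/
theorem lamSeven_k1_l11_ev10_top (K : Type*) [NontriviallyNormedField K] [NormedAlgebra ℚ_[7] K] [IsUltrametricDist K] [ProperSpace K]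
    {q : K} (he : absRamificationIdx 7 K = 10 * 11) (hq : ‖q‖ = (7 : ℝ) ^ (-((1 : ℕ) : ℝ) / (11 : ℕ))) :
    q ∉ q ^ (5 ^ 2) • logShell (PadicLogOnUnits.ofUnitLog 7 K) :=
  hex_cell_neg_of_bracket_of_not_six_dvd K (k := 1) (l := 11) (ev := 10) (by norm_num) he (by norm_num)
    (by rw [hq]; norm_num) (s₁ := 1) (a₁ := 2) (a₂ := 2) le_rfl (by norm_num)
    (fun a ha => by interval_cases a <;> norm_num) (by norm_num) (by norm_num)

/-- **PRINT'S WORKED DATUM DH11a1, LABEL 3** (Dupuy–Hilado 2004.13228v2 §2.10; abc-iut-rp-h2's `EvalI06StarDH11a1`: `p = 11`, `e = 78`,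
`‖q̲‖^{26} = 11^{−5}` so `m = 15`; `j = 3`, `N = 78 − 8·15 = −42`; bracket `s₁ = 3`, `a₁ = 1` (`33 − 78 = −45 < −42`), `a₂ = 1`
(`40 < 78 ≤ 440`; `44 − 78 = −34 > −42`); `10 ∤ 78`): **`q̲ ∉ q̲⁹ · ℐ_K`** — the `j = 3` cell, «OPEN-shape» by balls, is NEG by the gap, so the
datum's label profile is `{1, 2}` POS / `{3, 4, 5, 6}` NEG as typed (with `dh11a1_cells`). [claim: Mochizuki2012, status: disputed] -/
theorem dh11a1_label3_not_mem (K : Type*) [NontriviallyNormedField K] [NormedAlgebra ℚ_[11] K] [IsUltrametricDist K] [ProperSpace K]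
    (he : absRamificationIdx 11 K = 78) {q : K} (hqN : ‖q‖ ^ 26 = ((11 : ℕ) : ℝ) ^ (-(5 : ℝ))) :
    q ∉ q ^ 9 • logShell (PadicLogOnUnits.ofUnitLog 11 K) := by
  haveI : Fact (Nat.Prime 11) := ⟨by norm_num⟩
  have hnd : ¬ (11 - 1) ∣ absRamificationIdx 11 K := by rw [he]; norm_num
  have htf := tieFree_of_not_dvd 11 K hnd (3 : ℕ)
  rw [he] at htf
  exact not_mem_pow_smul_logShell_of_bracket_root 11 K (by norm_num) he (D := 26) (H := 5) (m := 15) (by norm_num)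
    (by exact_mod_cast hqN) (by norm_num) (n := 9) (s₁ := 3) (a₁ := 1) (a₂ := 1) (by norm_num) (by norm_num)
    (fun a ha => by interval_cases a; norm_num) (by norm_num) (by norm_num) htf

end Templates

/-! ## §2. The remaining `λ_k` top-label cells at `k = 1` (R-W local types `ev ∈ {6, 15, 30}`; `ev = 10` above; `ev ≤ 5` were NEG by balls) -/

section LamSevenK1

variable (K : Type*) [NontriviallyNormedField K] [NormedAlgebra ℚ_[7] K] [IsUltrametricDist K] [ProperSpace K]

/-- **ROW `lamSeven:k=1:l=11 @p7.j5.ev6`** (`e = 66`, `6 ∣ e`: tie only at level `11`; `N = 66 − 144 = −78 ∈ (φ(1), φ(2)) = (−83, −52)`;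
bracket `s₁ = 1, a₁ = 2, a₂ = 1`, tie bound `A = 3`). [claim: Mochizuki2012, status: disputed] -/
theorem lamSeven_k1_l11_ev6_top {q : K} (he : absRamificationIdx 7 K = 6 * 11) (hq : ‖q‖ = (7 : ℝ) ^ (-((1 : ℕ) : ℝ) / (11 : ℕ))) :
    q ∉ q ^ (5 ^ 2) • logShell (PadicLogOnUnits.ofUnitLog 7 K) :=
  hex_cell_neg_of_bracket K (k := 1) (l := 11) (ev := 6) (by norm_num) he (by rw [hq]; norm_num)
    (s₁ := 1) (a₁ := 2) (a₂ := 1) (A := 3) le_rfl (by norm_num) (fun a ha => by interval_cases a; norm_num) (by norm_num)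
    (by norm_num) (by norm_num) (by decide)

/-- **ROW `lamSeven:k=1:l=11 @p7.j5.ev15`** (`e = 165`, `6 ∤ e`; `N = 165 − 360 = −195 ∈ (φ(2), φ(3)) = (−232, −183)`; `s₁ = 2, a₁ = a₂ = 2`).
[claim: Mochizuki2012, status: disputed] -/
theorem lamSeven_k1_l11_ev15_top {q : K} (he : absRamificationIdx 7 K = 15 * 11) (hq : ‖q‖ = (7 : ℝ) ^ (-((1 : ℕ) : ℝ) / (11 : ℕ))) :
    q ∉ q ^ (5 ^ 2) • logShell (PadicLogOnUnits.ofUnitLog 7 K) :=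
  hex_cell_neg_of_bracket_of_not_six_dvd K (k := 1) (l := 11) (ev := 15) (by norm_num) he (by norm_num)
    (by rw [hq]; norm_num) (s₁ := 2) (a₁ := 2) (a₂ := 2) (by norm_num) (by norm_num)
    (fun a ha => by interval_cases a <;> norm_num) (by norm_num) (by norm_num)

/-- **ROW `lamSeven:k=1:l=11 @p7.j5.ev30`** (`e = 330`, `6 ∣ e`: tie only at level `55`; `N = 330 − 720 = −390 ∈ (φ(5), φ(6)) = (−415, −366)`;
`s₁ = 5, a₁ = a₂ = 2`, `A = 3`). [claim: Mochizuki2012, status: disputed] -/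
theorem lamSeven_k1_l11_ev30_top {q : K} (he : absRamificationIdx 7 K = 30 * 11) (hq : ‖q‖ = (7 : ℝ) ^ (-((1 : ℕ) : ℝ) / (11 : ℕ))) :
    q ∉ q ^ (5 ^ 2) • logShell (PadicLogOnUnits.ofUnitLog 7 K) :=
  hex_cell_neg_of_bracket K (k := 1) (l := 11) (ev := 30) (by norm_num) he (by rw [hq]; norm_num)
    (s₁ := 5) (a₁ := 2) (a₂ := 2) (A := 3) (by norm_num) (by norm_num) (fun a ha => by interval_cases a <;> norm_num) (by norm_num)
    (by norm_num) (by norm_num) (by decide)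

/-- **ROW `lamSeven:k=1:l=13 @p7.j6.ev15`** (`e = 195`, `6 ∤ e`; `N = 195 − 525 = −330 ∈ (φ(1), φ(2)) = (−341, −292)`; `s₁ = 1, a₁ = a₂ = 2`).
[claim: Mochizuki2012, status: disputed] -/
theorem lamSeven_k1_l13_ev15_top {q : K} (he : absRamificationIdx 7 K = 15 * 13) (hq : ‖q‖ = (7 : ℝ) ^ (-((1 : ℕ) : ℝ) / (13 : ℕ))) :
    q ∉ q ^ (6 ^ 2) • logShell (PadicLogOnUnits.ofUnitLog 7 K) :=
  hex_cell_neg_of_bracket_of_not_six_dvd K (k := 1) (l := 13) (ev := 15) (by norm_num) he (by norm_num)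
    (by rw [hq]; norm_num) (s₁ := 1) (a₁ := 2) (a₂ := 2) le_rfl (by norm_num)
    (fun a ha => by interval_cases a <;> norm_num) (by norm_num) (by norm_num)

/-- **ROW `lamSeven:k=1:l=13 @p7.j6.ev30`** (`e = 390`, `6 ∣ e`: tie only at level `65`; `N = 390 − 1050 = −660 ∈ (φ(2), φ(3)) = (−682, −633)`;
`s₁ = 2, a₁ = a₂ = 2`, `A = 4`). [claim: Mochizuki2012, status: disputed] -/
theorem lamSeven_k1_l13_ev30_top {q : K} (he : absRamificationIdx 7 K = 30 * 13) (hq : ‖q‖ = (7 : ℝ) ^ (-((1 : ℕ) : ℝ) / (13 : ℕ))) :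
    q ∉ q ^ (6 ^ 2) • logShell (PadicLogOnUnits.ofUnitLog 7 K) :=
  hex_cell_neg_of_bracket K (k := 1) (l := 13) (ev := 30) (by norm_num) he (by rw [hq]; norm_num)
    (s₁ := 2) (a₁ := 2) (a₂ := 2) (A := 4) (by norm_num) (by norm_num) (fun a ha => by interval_cases a <;> norm_num) (by norm_num)
    (by norm_num) (by norm_num) (by decide)

end LamSevenK1

/-! ## §3. (v2 append) ONE decl per `l`: the `k = 1` top-label cell FAILS at EVERY R-W local type `e = ev·l`, `ev ∣ 30` (A1) -/

section LamSevenK1All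

open Summit.ABC.IUTFork.Repair.CandInternal2RealSharp

variable (K : Type*) [NontriviallyNormedField K] [NormedAlgebra ℚ_[7] K] [IsUltrametricDist K] [ProperSpace K]

/-- The divisors of `30`. [folklore] -/
theorem eq_of_dvd_thirty {ev : ℕ} (hev : ev ∣ 30) :
    ev = 1 ∨ ev = 2 ∨ ev = 3 ∨ ev = 5 ∨ ev = 6 ∨ ev = 10 ∨ ev = 15 ∨ ev = 30 := by
  obtain ⟨t, ht⟩ := hev
  have hle : ev ≤ 30 := Nat.le_of_dvd (by norm_num) ⟨t, ht⟩
  interval_cases ev <;> omega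

/-- **`λ_k` FAMILY, `k = 1`, `l = 11`: the TOP-LABEL cell (`j = 5`) FAILS at EVERY local type of R-W's assumption A1** — `K/ℚ₇` with
`e(K) = ev·11`, `ev ∣ 30` (hypotheses on the place, never asserted), `‖q̲‖ = 7^{−1/11}` ⟹ `q̲ ∉ q̲^{25}·ℐ_K`: types `ev ∈ {1, 2, 3, 5}` by
abc-iut-rp-x2's sharp window edge (`CandInternal2RealSharp.not_mem_of_lt_sharp_of_window`, windows `k = 1, 1, 1, 2`), types
`ev ∈ {6, 10, 15, 30}` by the gap rows of §1–§2. With `CandInternal2RealHex.i06star_topLabel_false_A1` (`k ≥ 2`) the top cell of EVERY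
`lamSeven` row of `I06STAR-COLUMNS` (`l = 11`) is NEG by these two decls. [claim: Mochizuki2012, status: disputed] -/
theorem lamSeven_k1_l11_top_false_of_dvd_thirty {q : K} {ev : ℕ} (he : absRamificationIdx 7 K = ev * 11) (hev : ev ∣ 30)
    (hq : ‖q‖ = (7 : ℝ) ^ (-((1 : ℕ) : ℝ) / (11 : ℕ))) : q ∉ q ^ (5 ^ 2) • logShell (PadicLogOnUnits.ofUnitLog 7 K) := by
  haveI : Fact (Nat.Prime 7) := ⟨by norm_num⟩
  have hqh : ‖q‖ = (7 : ℝ) ^ (-(((1 : ℕ) : ℝ) / (11 : ℕ))) := by rw [hq, neg_div]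
  rcases eq_of_dvd_thirty hev with rfl | rfl | rfl | rfl | rfl | rfl | rfl | rfl
  · exact not_mem_of_lt_sharp_of_window 7 K (k := 1) le_rfl (by rw [he]; norm_num) (by rw [he]; norm_num) hqh
      (by rw [he]; norm_num)
  · exact not_mem_of_lt_sharp_of_window 7 K (k := 1) le_rfl (by rw [he]; norm_num) (by rw [he]; norm_num) hqh
      (by rw [he]; norm_num)
  · exact not_mem_of_lt_sharp_of_window 7 K (k := 1) le_rfl (by rw [he]; norm_num) (by rw [he]; norm_num) hqh
      (by rw [he]; norm_num)
  · exact not_mem_of_lt_sharp_of_window 7 K (k := 2) (by norm_num) (by rw [he]; norm_num) (by rw [he]; norm_num) hqh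
      (by rw [he]; norm_num)
  · exact lamSeven_k1_l11_ev6_top K he hq
  · exact lamSeven_k1_l11_ev10_top K he hq
  · exact lamSeven_k1_l11_ev15_top K he hq
  · exact lamSeven_k1_l11_ev30_top K he hq

/-- **`λ_k` FAMILY, `k = 1`, `l = 13`: the TOP-LABEL cell (`j = 6`) FAILS at EVERY local type `e(K) = ev·13`, `ev ∣ 30`**, `‖q̲‖ = 7^{−1/13}`
⟹ `q̲ ∉ q̲^{36}·ℐ_K`: types `ev ∈ {1, 2, 3, 5, 6, 10}` by the sharp window edge (windows `1, 1, 1, 2, 2, 2`), `ev ∈ {15, 30}` by the gap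
rows of §2. With `CandInternal2RealHex.i06star_topLabel_false_A1` (`k ≥ 2`) every `lamSeven` top cell at `l = 13` is NEG.
[claim: Mochizuki2012, status: disputed] -/
theorem lamSeven_k1_l13_top_false_of_dvd_thirty {q : K} {ev : ℕ} (he : absRamificationIdx 7 K = ev * 13) (hev : ev ∣ 30)
    (hq : ‖q‖ = (7 : ℝ) ^ (-((1 : ℕ) : ℝ) / (13 : ℕ))) : q ∉ q ^ (6 ^ 2) • logShell (PadicLogOnUnits.ofUnitLog 7 K) := by
  haveI : Fact (Nat.Prime 7) := ⟨by norm_num⟩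
  have hqh : ‖q‖ = (7 : ℝ) ^ (-(((1 : ℕ) : ℝ) / (13 : ℕ))) := by rw [hq, neg_div]
  rcases eq_of_dvd_thirty hev with rfl | rfl | rfl | rfl | rfl | rfl | rfl | rfl
  · exact not_mem_of_lt_sharp_of_window 7 K (k := 1) le_rfl (by rw [he]; norm_num) (by rw [he]; norm_num) hqh
      (by rw [he]; norm_num)
  · exact not_mem_of_lt_sharp_of_window 7 K (k := 1) le_rfl (by rw [he]; norm_num) (by rw [he]; norm_num) hqh
      (by rw [he]; norm_num)
  · exact not_mem_of_lt_sharp_of_window 7 K (k := 1) le_rfl (by rw [he]; norm_num) (by rw [he]; norm_num) hqh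
      (by rw [he]; norm_num)
  · exact not_mem_of_lt_sharp_of_window 7 K (k := 2) (by norm_num) (by rw [he]; norm_num) (by rw [he]; norm_num) hqh
      (by rw [he]; norm_num)
  · exact not_mem_of_lt_sharp_of_window 7 K (k := 2) (by norm_num) (by rw [he]; norm_num) (by rw [he]; norm_num) hqh
      (by rw [he]; norm_num)
  · exact not_mem_of_lt_sharp_of_window 7 K (k := 2) (by norm_num) (by rw [he]; norm_num) (by rw [he]; norm_num) hqh
      (by rw [he]; norm_num)
  · exact lamSeven_k1_l13_ev15_top K he hq
  · exact lamSeven_k1_l13_ev30_top K he hq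

end LamSevenK1All

end Summit.ABC.IUTFork.Repair.CandInternal2RealGapRows

end
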